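import Summits.BirchSwinnertonDyer.BirchSwinnertonDyer.Theorems.LeadingTermPinchPrimeSemisimpleIffSchneiderInfinitelyOften
import Summits.BirchSwinnertonDyer.BirchSwinnertonDyer.Theorems.LeadingTermPinchPrimePinchAtOfAnalyticRankLeOne
import Summits.BirchSwinnertonDyer.BirchSwinnertonDyer.Theorems.LeadingTermPinchPrimeSchneiderOfHasCMRankLeOne
import Summits.BirchSwinnertonDyer.BirchSwinnertonDyer.Theorems.LeadingTermPinchPrimePinchPrimeOfOpenRanges
import Literature.NumberTheory.EllipticCurves.SelmerCorankControlRatOrdinaryProofs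
import Literature.NumberTheory.EllipticCurves.SupersingularDensityProofs
import Literature.NumberTheory.EllipticCurves.BertrandCMHeightNonvanishing
import Literature.NumberTheory.EllipticCurves.LeadingTerm

/-!
# Crux `PinchPrime` (stmt-BirchSwinnertonDyer-16218), line `SketchIdeator2` — stub G11
# `stub_openStubs_of_residual`: the v16 open pair from the residual stubs A′, S′

Helper file (`--supports stmt-BirchSwinnertonDyer-16218`) for the lead skeleton
`Cruxes/PinchPrime/Lines/SketchIdeator2.lean` (v17, line cycle 5). It proves the registered glue
stub G11: the two v16 OPEN stubs of the line —

* (A) for every elliptic `E/ℚ` (globally minimal `W`), `Ш(E/ℚ)[p^∞]` is finite for all but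
  finitely many good ordinary `p`;
* (B) for every such `W`, outside any finite set there is a good ordinary `p ≥ 5` with a
  cyclotomic `ℤ_p`-extension `κ` and a normalised topological generator `γ` such that
  multiplication by `T` on `ℚ_p ⊗ X(E/ℚ_∞)` is semisimple at `0` (`ker T² = ker T`) for every
  Iwasawa datum —

follow from the RESIDUAL stubs

* (A′) the same as (A), asked only for curves of analytic rank `≥ 2`;
* (S′) Schneider non-degeneracy of the canonical cyclotomic `p`-adic height (`Reg_p(E, Dh) ≠ 0`)
  at infinitely many good ordinary `p ≥ 5`, asked only for curves of Mordell–Weil rank `≥ 1`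
  that are not CM curves of rank `1`,

modulo five theorem-grade named facts taken as hypotheses — Perrin-Riou–Schneider
(`Schneider1985_order_charGenerator`), modularity (`exists_isNewformOf`), the main conjecture under
irreducibility (`burungale_castella_skinner_charIdeal_eq_padicLFunction`), Gross–Zagier–Kolyvagin
(`rank_eq_analyticRank_of_analyticRank_le_one`) and Bertrand
(`bertrand_pairing_self_ne_zero_of_hasCM`) — and the tree theorem
`Greenberg1999_coinvariantsRank_eq_selmerCorank_rat_holds` (Mazur's control theorem in corank
form, discharged 2026-08-17). The argument: GZK gives (A) with `B = ∅` in analytic rank `≤ 1`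
(`cofiniteShaFinite_of_analyticRank_le_one`, landed with G7); Schneider non-degeneracy at
infinitely many good ordinary `p ≥ 5` holds for EVERY curve (`schneiderIO_of_residual`): in
Mordell–Weil rank `0` because `Reg_p = det ∅ = 1` (`schneider_of_mordellWeilRank_eq_zero`, landed
with G9) at any of the infinitely many good ordinary primes (`infinite_goodOrdinaryPrimes_holds`),
for CM curves of rank `≤ 1` by Bertrand (G8 `stub_schneider_of_hasCM_of_rank_le_one`), and by (S′)
otherwise; finally the landed classical reading G4
(`stub_semisimpleInfinitelyOften_iff_schneiderInfinitelyOften`) converts it into (B) given (A).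

References: Mazur–Stein–Tate 2006 Conj. 1.1 (Schneider's conjecture); Greenberg LNM 1716 §1
Conj. 1.12 and Thm 1.2; Darmon 2004 Thm 3.22 (GZK); Bertrand, LNM 1068 (1984) §3 Cor. 1.
-/

noncomputable section

-- D-0017: single-problem summit, so `Summit.BirchSwinnertonDyer.BirchSwinnertonDyer.…` repeats a
-- namespace BY DESIGN.
set_option linter.dupNamespace false

namespace Summit.BirchSwinnertonDyer.BirchSwinnertonDyer.Cruxes.PinchPrime.FirstLayerStability

open scoped MatrixGroups ModularForm
open CongruenceSubgroup Literature.NumberTheory.EllipticCurves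
  Literature.NumberTheory.EllipticCurves.ModularForms
open Summit.BirchSwinnertonDyer.BirchSwinnertonDyer.Theses

/-- Helper: every elliptic `E/ℚ` has a good ordinary prime `p ≥ 5` outside any finite set
(`infinite_goodOrdinaryPrimes_holds`: the good ordinary primes are infinite — Serre/Deuring,
PROVED in the tree). [folklore] -/
theorem exists_goodOrdinary_five_le_not_mem (W : WeierstrassCurve ℚ) [W.IsElliptic]
    [W.IsGloballyMinimal] (B : Finset ℕ) :
    ∃ p ∉ B, ∃ _ : Fact p.Prime, 5 ≤ p ∧ IsOrdinaryAt W p := by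
  obtain ⟨p, ⟨hp, hgood, hnd⟩, hgt⟩ :=
    (WeierstrassCurve.infinite_goodOrdinaryPrimes_holds W).exists_gt (B.sup id ⊔ 4)
  have hpB : p ∉ B := fun hpB ↦ by
    have h1 : p ≤ B.sup id := Finset.le_sup (f := id) hpB
    exact absurd hgt (not_lt.mpr (le_sup_of_le_left h1))
  have h5 : 5 ≤ p := by
    have h4 : 4 < p := lt_of_le_of_lt le_sup_right hgt
    omega
  exact ⟨p, hpB, hp, h5, hgood, hnd⟩

/-- **Schneider non-degeneracy at infinitely many good ordinary primes, for EVERY curve, from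
S′** (PROVED; Bertrand's theorem as hypothesis): rank `0` is `Reg_p = det ∅ = 1`
(`schneider_of_mordellWeilRank_eq_zero`) at any of the infinitely many good ordinary primes
(`infinite_goodOrdinaryPrimes_holds`); CM of rank `≤ 1` is G8; the rest is S′.
[cite: Bertrand1984ThetaCM, §3 Corollaire 1] [cite: MazurSteinTate2006, Conj. 1.1] -/
theorem schneiderIO_of_residual (hBer : bertrand_pairing_self_ne_zero_of_hasCM)
    (hS : ∀ (W : WeierstrassCurve ℚ) [W.IsElliptic] [W.IsGloballyMinimal], 1 ≤ W.mordellWeilRank →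
      (W.HasCM → 2 ≤ W.mordellWeilRank) → ∀ B : Finset ℕ,
        ∃ p ∉ B, ∃ _ : Fact p.Prime, 5 ≤ p ∧ IsOrdinaryAt W p ∧
          ∀ Dh : WeierstrassCurve.PAdicHeightData W p, Dh.IsCanonical →
            WeierstrassCurve.SchneiderConjecture Dh)
    (W : WeierstrassCurve ℚ) [W.IsElliptic] [W.IsGloballyMinimal] (B : Finset ℕ) :
    ∃ p ∉ B, ∃ _ : Fact p.Prime, 5 ≤ p ∧ IsOrdinaryAt W p ∧
      ∀ Dh : WeierstrassCurve.PAdicHeightData W p, Dh.IsCanonical →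
        WeierstrassCurve.SchneiderConjecture Dh := by
  -- the two KNOWN ranges: Schneider at EVERY good ordinary `p ≥ 5`
  by_cases hknown : W.mordellWeilRank = 0 ∨ (W.HasCM ∧ W.mordellWeilRank ≤ 1)
  · obtain ⟨p, hpB, hp, h5, hord⟩ := exists_goodOrdinary_five_le_not_mem W B
    refine ⟨p, hpB, hp, h5, hord, fun Dh hDh ↦ ?_⟩
    rcases hknown with h0 | ⟨hCM, hle⟩
    · exact schneider_of_mordellWeilRank_eq_zero W p h0 Dh
    · exact stub_schneider_of_hasCM_of_rank_le_one hBer W hCM hle p h5 hord Dh hDh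
  -- the OPEN range: S′
  · have h0 : W.mordellWeilRank ≠ 0 := fun h ↦ hknown (Or.inl h)
    have hCM : W.HasCM → 2 ≤ W.mordellWeilRank := fun h ↦ by
      by_contra hlt
      exact hknown (Or.inr ⟨h, by omega⟩)
    exact hS W (Nat.one_le_iff_ne_zero.mpr h0) hCM B

/-- **The v16 open stub (A) for every curve, from A′** (PROVED; GZK as hypothesis).
[cite: Darmon2004, Thm. 3.22] -/
theorem cofiniteShaFinite_of_residual (hGZK : rank_eq_analyticRank_of_analyticRank_le_one)
    (hA : ∀ (W : WeierstrassCurve ℚ) [W.IsElliptic] [W.IsGloballyMinimal], 2 ≤ W.analyticRank →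
      ∃ B : Finset ℕ, ∀ p ∉ B, ∀ [Fact p.Prime], IsOrdinaryAt W p →
        Finite (AddCommGroup.primaryComponent W.sha p))
    (W : WeierstrassCurve ℚ) [W.IsElliptic] [W.IsGloballyMinimal] :
    ∃ B : Finset ℕ, ∀ p ∉ B, ∀ [Fact p.Prime], IsOrdinaryAt W p →
      Finite (AddCommGroup.primaryComponent W.sha p) := by
  by_cases h : W.analyticRank ≤ 1
  · exact cofiniteShaFinite_of_analyticRank_le_one hGZK W h
  · exact hA W (by omega)

/-- **Stub G11 `stub_openStubs_of_residual`** (crux `PinchPrime`, line `SketchIdeator2`): modulo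
PRS, modularity, BCS, GZK and Bertrand (hypotheses), the residual stubs (A′) — cofinite finiteness
of `Ш(E/ℚ)[p^∞]` for the curves of analytic rank `≥ 2` — and (S′) — Schneider non-degeneracy at
infinitely many good ordinary `p ≥ 5` for the curves of Mordell–Weil rank `≥ 1` that are not CM of
rank `1` — imply the two v16 open stubs for EVERY curve: (A) cofinite finiteness of `Ш[p^∞]` and
(B) semisimplicity of `T` at `0` on `ℚ_p ⊗ X(E/ℚ_∞)` at infinitely many good ordinary `p ≥ 5` with
the normalised cyclotomic datum. [cite: MazurSteinTate2006, Conj. 1.1]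
[cite: GreenbergLNM1716, §1 Conj. 1.12 and p. 9] [cite: Darmon2004, Thm. 3.22]
[cite: Bertrand1984ThetaCM, §3 Corollaire 1] -/
theorem stub_openStubs_of_residual :
    Schneider1985_order_charGenerator → exists_isNewformOf →
    burungale_castella_skinner_charIdeal_eq_padicLFunction →
    rank_eq_analyticRank_of_analyticRank_le_one → bertrand_pairing_self_ne_zero_of_hasCM →
    (∀ (W : WeierstrassCurve ℚ) [W.IsElliptic] [W.IsGloballyMinimal], 2 ≤ W.analyticRank →
      ∃ B : Finset ℕ, ∀ p ∉ B, ∀ [Fact p.Prime], IsOrdinaryAt W p →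
        Finite (AddCommGroup.primaryComponent W.sha p)) →
    (∀ (W : WeierstrassCurve ℚ) [W.IsElliptic] [W.IsGloballyMinimal], 1 ≤ W.mordellWeilRank →
      (W.HasCM → 2 ≤ W.mordellWeilRank) → ∀ B : Finset ℕ,
        ∃ p ∉ B, ∃ _ : Fact p.Prime, 5 ≤ p ∧ IsOrdinaryAt W p ∧
          ∀ Dh : WeierstrassCurve.PAdicHeightData W p, Dh.IsCanonical →
            WeierstrassCurve.SchneiderConjecture Dh) →
    (∀ (W : WeierstrassCurve ℚ) [W.IsElliptic] [W.IsGloballyMinimal],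
      ∃ B : Finset ℕ, ∀ p ∉ B, ∀ [Fact p.Prime], IsOrdinaryAt W p →
        Finite (AddCommGroup.primaryComponent W.sha p)) ∧
    (∀ (W : WeierstrassCurve ℚ) [W.IsElliptic] [W.IsGloballyMinimal], ∀ B : Finset ℕ,
      ∃ p ∉ B, ∃ _ : Fact p.Prime, 5 ≤ p ∧ IsOrdinaryAt W p ∧
        ∃ (κ : ZpExtension ℚ p) (γ : Field.absoluteGaloisGroup ℚ),
          κ.IsCyclotomic ∧ κ.IsTopGenerator γ ∧ IsCyclotomicVariable p γ ∧
          ∀ D : W.SelmerDualData κ γ,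
            LinearMap.ker (IwasawaAlgebra.mulTRat p D.X ∘ₗ IwasawaAlgebra.mulTRat p D.X)
              = LinearMap.ker (IwasawaAlgebra.mulTRat p D.X)) := by
  intro hPRS hmod hBCS hGZK hBer hA hS
  exact ⟨fun W _ _ ↦ cofiniteShaFinite_of_residual hGZK hA W, fun W _ _ B ↦
    (stub_semisimpleInfinitelyOften_iff_schneiderInfinitelyOften hPRS
      Greenberg1999_coinvariantsRank_eq_selmerCorank_rat_holds hmod hBCS W
      (cofiniteShaFinite_of_residual hGZK hA W)).mpr (schneiderIO_of_residual hBer hS W) B⟩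

end Summit.BirchSwinnertonDyer.BirchSwinnertonDyer.Cruxes.PinchPrime.FirstLayerStability

end
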